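import Summits.CriticalPhenomena.PercolationContinuityZ3.Theorems.PercNearOneGluingNoHeavyLowerTailSahiE4UnionTwoCoinY
import Summits.CriticalPhenomena.PercolationContinuityZ3.Theorems.PercNearOneGluingNoHeavyLowerTailSahiE4UnionAAdmOfH4Plus
import Summits.CriticalPhenomena.PercolationContinuityZ3.Theorems.PercNearOneGluingNoHeavyLowerTailSahiE4UnionHoldMoments
import Summits.CriticalPhenomena.PercolationContinuityZ3.Theorems.PercNearOneGluingNoHeavyLowerTailSahiE4UnionTensorMoments
import Mathlib.Tactic.LinearCombination
import HarnessLib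

/-!
# `NoHeavyLowerTail` (crux stmt-CriticalPhenomena-4575), Sahi programme P4 — the two-coin block `b = (c₁, c₂, c₂, c₁c₂)` at MEASURE level (part B)

Support file (cell `prim-l12`, seat P4, generation 39; `--supports stmt-CriticalPhenomena-4575`).  No definitions, no named facts, no sorries;
standard axioms.  `(γ,μ)`: finite preorder with a positively associated probability weight, `a : Fin 4 → γ → [0,1]` monotone with `H4Plus μ a`
(hence all 85 hold-moment rows, `aAdmissible_of_h4Plus`); `(β,ν)`: ANY finite probability space with two `{0,1}`-valued events `c₁, c₂` that are
independent under `ν` (`E c₁c₂ = E c₁ · E c₂`); block `b = (c₁, c₂, c₂, c₁c₂)`; `u_i = a_i + b_i − a_ib_i = a_i ∨ b_i` on `γ × β` with the product weight.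
THEOREMS: `E₄^{μ⊗ν}(u) ≥ 0` and the order-3 product rows `E₃^{μ⊗ν}(u_iu_j,u_k,u_l) ≥ 0`, from the hold-moment theorems of `…TwoCoinY` via the
joint-moment bookkeeping `SahiE4UnionHold.uMoment_S` / `exFail_S` and the fifteen block moments in terms of `E c₁, E c₂`.  HONEST FRAMING: one specific
non-read-once four-member block; the general four-member step is open. [this work]
-/

noncomputable section

namespace Summit.CriticalPhenomena.PercolationContinuityZ3.Theorems.SahiE4UnionTwoCoin

open Finset Function Literature.Combinatorics.Sahi2008
open Summit.CriticalPhenomena.PercolationContinuityZ3.Theorems.SahiE3UnionTensor (ex_add' ex_sub' sum_prodWeight ex_tensor)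
open Summit.CriticalPhenomena.PercolationContinuityZ3.Theorems.SahiE4UnionTensor (sahiE_four_apply)
open Summit.CriticalPhenomena.PercolationContinuityZ3.Theorems.SahiE4UnionHold
open Summit.CriticalPhenomena.PercolationContinuityZ3.Theorems.SahiE4UnionThree
open Summit.CriticalPhenomena.PercolationContinuityZ3.Theorems.SahiH4Plus

variable {γ β : Type*} [Fintype γ] [Fintype β] [Preorder γ]

set_option maxHeartbeats 1600000 in
set_option maxRecDepth 8000 in
/-- `e3prod03_orTwoCoinY_nonneg` restated with powers written as repeated products (elaboration-friendly form). [this work] -/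
theorem e3prod03_orTwoCoinY_nonneg' (t : Fin 15 → ℝ) (α β : ℝ) (hT : AAdmissible t) (hα0 : 0 ≤ α) (hα1 : α ≤ 1) (hβ0 : 0 ≤ β) (hβ1 : β ≤ 1) :
    0 ≤ 2 * t 14 - t 1 * t 12 - t 2 * t 11 - t 6 * t 7 + t 6 * β - t 11 * β - t 12 * β + 2 * t 13 * α - 2 * t 14 * α - 2 * t 14 * β + 2 * α * β + t 1 * t 2 * t 6 - t 1 * t 9 * α + t 1 * t 12 * α + 2 * t 1 * t 12 * β - t 1 * α * β - t 2 * t 8 * α + t 2 * t 11 * α + 2 * t 2 * t 11 * β - t 2 * α * β - t 3 * t 7 * α - t 3 * α * β + t 6 * t 7 * α + t 6 * t 7 * β - t 6 * α * β - t 6 * β * β - t 7 * α * β - t 8 * α * β - t 9 * α * β + t 11 * α * β + t 11 * β * β + t 12 * α * β + t 12 * β * β - 2 * t 13 * α * β + 2 * t 14 * α * β - 3 * α * β * β + t 1 * t 2 * t 3 * α - t 1 * t 2 * t 6 * α - 2 * t 1 * t 2 * t 6 * β + t 1 * t 2 * α * β + t 1 * t 3 * α * β + 2 * t 1 * t 9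 * α * β - 2 * t 1 * t 12 * α * β - t 1 * t 12 * β * β + 2 * t 1 * α * β * β + t 2 * t 3 * α * β + 2 * t 2 * t 8 * α * β - 2 * t 2 * t 11 * α * β - t 2 * t 11 * β * β + 2 * t 2 * α * β * β + 2 * t 3 * t 7 * α * β + 2 * t 3 * α * β * β - t 6 * t 7 * α * β + t 6 * α * β * β + t 7 * α * β * β + t 8 * α * β * β + t 9 * α * β * β - t 11 * α * β * β - t 12 * α * β * β + α * β * β * β - 3 * t 1 * t 2 * t 3 * α * β + 2 * t 1 * t 2 * t 6 * α * β + t 1 * t 2 * t 6 * β * β - 2 * t 1 * t 2 * α * β * β - 2 * t 1 * t 3 * α * β * β - t 1 * t 9 * α * β * β + t 1 * t 12 * α * β * β - t 1 * α * β * β * β - 2 * t 2 * t 3 * α * β * β - t 2 * t 8 * α * β * β + t 2 * t 11 * α * β * β - t 2 * α * β * β * β - t 3 * t 7 * α * β * β - t 3 * α * β * β * β + 3 * t 1 * t 2 * t 3 * α * β * β - t 1 * t 2 * t 6 * α * β * β + t 1 * t 2 * α * β * β * β + t 1 * t 3 * α * β * β * β + t 2 * t 3 * α * β * β * β - t 1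 * t 2 * t 3 * α * β * β * β := by
  have h := e3prod03_orTwoCoinY_nonneg t α β hT hα0 hα1 hβ0 hβ1
  linear_combination h

set_option maxRecDepth 8000 in
/-- `e3prod03_orTwoCoinY_nonneg` with the fifteen hold moments as named reals. [this work] -/
theorem e3prod03_orTwoCoinY_nonneg_explicit (t0 t1 t2 t3 t01 t02 t03 t12 t13 t23 t012 t013 t023 t123 t0123 θ₁ θ₂ : ℝ)
    (hT : AAdmissible ![t0, t1, t2, t3, t01, t02, t03, t12, t13, t23, t012, t013, t023, t123, t0123]) (h10 : 0 ≤ θ₁) (h11 : θ₁ ≤ 1) (h20 : 0 ≤ θ₂) (h21 : θ₂ ≤ 1) :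
    0 ≤ 2 * t0123 - t1 * t023 - t2 * t013 - t03 * t12 + t03 * θ₂ - t013 * θ₂ - t023 * θ₂ + 2 * t123 * θ₁ - 2 * t0123 * θ₁ - 2 * t0123 * θ₂ + 2 * θ₁ * θ₂ + t1 * t2 * t03 - t1 * t23 * θ₁ + t1 * t023 * θ₁ + 2 * t1 * t023 * θ₂ - t1 * θ₁ * θ₂ - t2 * t13 * θ₁ + t2 * t013 * θ₁ + 2 * t2 * t013 * θ₂ - t2 * θ₁ * θ₂ - t3 * t12 * θ₁ - t3 * θ₁ * θ₂ + t03 * t12 * θ₁ + t03 * t12 * θ₂ - t03 * θ₁ * θ₂ - t03 * θ₂ * θ₂ - t12 * θ₁ * θ₂ - t13 * θ₁ * θ₂ - t23 * θ₁ * θ₂ + t013 * θ₁ * θ₂ + t013 * θ₂ * θ₂ + t023 * θ₁ * θ₂ + t023 * θ₂ * θ₂ - 2 * t123 * θ₁ * θ₂ + 2 * t0123 * θ₁ * θ₂ - 3 * θ₁ * θ₂ * θ₂ + t1 * t2 * t3 * θ₁ - t1 * t2 * t03 * θ₁ - 2 * t1 * t2 * t03 * θ₂ + t1 * t2 * θ₁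 * θ₂ + t1 * t3 * θ₁ * θ₂ + 2 * t1 * t23 * θ₁ * θ₂ - 2 * t1 * t023 * θ₁ * θ₂ - t1 * t023 * θ₂ * θ₂ + 2 * t1 * θ₁ * θ₂ * θ₂ + t2 * t3 * θ₁ * θ₂ + 2 * t2 * t13 * θ₁ * θ₂ - 2 * t2 * t013 * θ₁ * θ₂ - t2 * t013 * θ₂ * θ₂ + 2 * t2 * θ₁ * θ₂ * θ₂ + 2 * t3 * t12 * θ₁ * θ₂ + 2 * t3 * θ₁ * θ₂ * θ₂ - t03 * t12 * θ₁ * θ₂ + t03 * θ₁ * θ₂ * θ₂ + t12 * θ₁ * θ₂ * θ₂ + t13 * θ₁ * θ₂ * θ₂ + t23 * θ₁ * θ₂ * θ₂ - t013 * θ₁ * θ₂ * θ₂ - t023 * θ₁ * θ₂ * θ₂ + θ₁ * θ₂ * θ₂ * θ₂ - 3 * t1 * t2 * t3 * θ₁ * θ₂ + 2 * t1 * t2 * t03 * θ₁ * θ₂ + t1 * t2 * t03 * θ₂ * θ₂ - 2 * t1 * t2 * θ₁ * θ₂ * θ₂ - 2 * t1 * t3 * θ₁ * θ₂ * θ₂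 - t1 * t23 * θ₁ * θ₂ * θ₂ + t1 * t023 * θ₁ * θ₂ * θ₂ - t1 * θ₁ * θ₂ * θ₂ * θ₂ - 2 * t2 * t3 * θ₁ * θ₂ * θ₂ - t2 * t13 * θ₁ * θ₂ * θ₂ + t2 * t013 * θ₁ * θ₂ * θ₂ - t2 * θ₁ * θ₂ * θ₂ * θ₂ - t3 * t12 * θ₁ * θ₂ * θ₂ - t3 * θ₁ * θ₂ * θ₂ * θ₂ + 3 * t1 * t2 * t3 * θ₁ * θ₂ * θ₂ - t1 * t2 * t03 * θ₁ * θ₂ * θ₂ + t1 * t2 * θ₁ * θ₂ * θ₂ * θ₂ + t1 * t3 * θ₁ * θ₂ * θ₂ * θ₂ + t2 * t3 * θ₁ * θ₂ * θ₂ * θ₂ - t1 * t2 * t3 * θ₁ * θ₂ * θ₂ * θ₂ := by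
  have h := e3prod03_orTwoCoinY_nonneg' _ θ₁ θ₂ hT h10 h11 h20 h21
  exact h

set_option maxHeartbeats 4000000 in
set_option maxRecDepth 100000 in
/-- **`E₃(u_0u_3, u_1, u_2) ≥ 0` (order-3 product row) for the OR with the independent two-coin block `b = (c₁, c₂, c₂, c₁c₂)`** (measure level, hypotheses as in `sahiE_four_orTwoCoinY_nonneg`). [this work] -/
theorem sahiE_three_prodRow03_orTwoCoinY_nonneg (μ : γ → ℝ) (ν : β → ℝ)
    (hμ0 : ∀ t, 0 ≤ μ t) (hμ1 : ∑ t, μ t = 1) (hν0 : ∀ t, 0 ≤ ν t) (hν1 : ∑ t, ν t = 1) (hμ2 : SahiPositive μ 2)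
    (a : Fin 4 → γ → ℝ) (b : Fin 4 → β → ℝ) (ha0 : ∀ i t, 0 ≤ a i t) (ha1 : ∀ i t, a i t ≤ 1) (ham : ∀ i, Monotone (a i))
    (c₁ c₂ : β → ℝ) (hc₁ : ∀ y, c₁ y = 0 ∨ c₁ y = 1) (hc₂ : ∀ y, c₂ y = 0 ∨ c₂ y = 1) (hind : ex ν (c₁ * c₂) = ex ν c₁ * ex ν c₂)
    (hb0 : b 0 = c₁) (hb1 : b 1 = c₂) (hb2 : b 2 = c₂) (hb3 : b 3 = c₁ * c₂) (h : H4Plus μ a) :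
    0 ≤ sahiE (fun p : γ × β => μ p.1 * ν p.2) 3 ![(fun (i : Fin 4) (p : γ × β) => a i p.1 + b i p.2 - a i p.1 * b i p.2) 0 * (fun (i : Fin 4) (p : γ × β) => a i p.1 + b i p.2 - a i p.1 * b i p.2) 3, (fun (i : Fin 4) (p : γ × β) => a i p.1 + b i p.2 - a i p.1 * b i p.2) 1, (fun (i : Fin 4) (p : γ × β) => a i p.1 + b i p.2 - a i p.1 * b i p.2) 2] := by
  have hT := aAdmissible_of_h4Plus μ hμ0 hμ1 hμ2 a ha0 ha1 ham h
  have h10 : 0 ≤ ex ν c₁ := ex_nonneg hν0 (fun y => by rcases hc₁ y with e | e <;> simp [e])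
  have h11 : ex ν c₁ ≤ 1 := by
    have t := ex_mono hν0 (fun y => show c₁ y ≤ (fun _ => (1:ℝ)) y by rcases hc₁ y with e | e <;> simp [e]); rw [ex_const hν1] at t; exact t
  have h20 : 0 ≤ ex ν c₂ := ex_nonneg hν0 (fun y => by rcases hc₂ y with e | e <;> simp [e])
  have h21 : ex ν c₂ ≤ 1 := by
    have t := ex_mono hν0 (fun y => show c₂ y ≤ (fun _ => (1:ℝ)) y by rcases hc₂ y with e | e <;> simp [e]); rw [ex_const hν1] at t; exact t
  have mb0 : ex ν (b 0) = ex ν c₁ := by rw [hb0]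
  have mb1 : ex ν (b 1) = ex ν c₂ := by rw [hb1]
  have mb2 : ex ν (b 2) = ex ν c₂ := by rw [hb2]
  have mb3 : ex ν (b 3) = ex ν c₁ * ex ν c₂ := by rw [hb3, hind]
  have mb01 : ex ν (b 0 * b 1) = ex ν c₁ * ex ν c₂ := by
    have e : (b 0 * b 1 : β → ℝ) = c₁ * c₂ := by
      funext y; simp only [hb0, hb1, Pi.mul_apply]
    rw [e, hind]
  have mb02 : ex ν (b 0 * b 2) = ex ν c₁ * ex ν c₂ := by
    have e : (b 0 * b 2 : β → ℝ) = c₁ * c₂ := by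
      funext y; simp only [hb0, hb2, Pi.mul_apply]
    rw [e, hind]
  have mb03 : ex ν (b 0 * b 3) = ex ν c₁ * ex ν c₂ := by
    have e : (b 0 * b 3 : β → ℝ) = c₁ * c₂ := by
      funext y; simp only [hb0, hb3, Pi.mul_apply]
      all_goals (rcases hc₁ y with h1 | h1 <;> rcases hc₂ y with h2 | h2 <;> simp [h1, h2])
    rw [e, hind]
  have mb12 : ex ν (b 1 * b 2) = ex ν c₂ := by
    have e : (b 1 * b 2 : β → ℝ) = c₂ := by
      funext y; simp only [hb1, hb2, Pi.mul_apply]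
      all_goals (rcases hc₂ y with h2 | h2 <;> simp [h2])
    rw [e]
  have mb13 : ex ν (b 1 * b 3) = ex ν c₁ * ex ν c₂ := by
    have e : (b 1 * b 3 : β → ℝ) = c₁ * c₂ := by
      funext y; simp only [hb1, hb3, Pi.mul_apply]
      all_goals (rcases hc₁ y with h1 | h1 <;> rcases hc₂ y with h2 | h2 <;> simp [h1, h2])
    rw [e, hind]
  have mb23 : ex ν (b 2 * b 3) = ex ν c₁ * ex ν c₂ := by
    have e : (b 2 * b 3 : β → ℝ) = c₁ * c₂ := by
      funext y; simp only [hb2, hb3, Pi.mul_apply]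
      all_goals (rcases hc₁ y with h1 | h1 <;> rcases hc₂ y with h2 | h2 <;> simp [h1, h2])
    rw [e, hind]
  have mb012 : ex ν (b 0 * b 1 * b 2) = ex ν c₁ * ex ν c₂ := by
    have e : (b 0 * b 1 * b 2 : β → ℝ) = c₁ * c₂ := by
      funext y; simp only [hb0, hb1, hb2, Pi.mul_apply]
      all_goals (rcases hc₁ y with h1 | h1 <;> rcases hc₂ y with h2 | h2 <;> simp [h1, h2])
    rw [e, hind]
  have mb013 : ex ν (b 0 * b 1 * b 3) = ex ν c₁ * ex ν c₂ := by
    have e : (b 0 * b 1 * b 3 : β → ℝ) = c₁ * c₂ := by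
      funext y; simp only [hb0, hb1, hb3, Pi.mul_apply]
      all_goals (rcases hc₁ y with h1 | h1 <;> rcases hc₂ y with h2 | h2 <;> simp [h1, h2])
    rw [e, hind]
  have mb023 : ex ν (b 0 * b 2 * b 3) = ex ν c₁ * ex ν c₂ := by
    have e : (b 0 * b 2 * b 3 : β → ℝ) = c₁ * c₂ := by
      funext y; simp only [hb0, hb2, hb3, Pi.mul_apply]
      all_goals (rcases hc₁ y with h1 | h1 <;> rcases hc₂ y with h2 | h2 <;> simp [h1, h2])
    rw [e, hind]
  have mb123 : ex ν (b 1 * b 2 * b 3) = ex ν c₁ * ex ν c₂ := by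
    have e : (b 1 * b 2 * b 3 : β → ℝ) = c₁ * c₂ := by
      funext y; simp only [hb1, hb2, hb3, Pi.mul_apply]
      all_goals (rcases hc₁ y with h1 | h1 <;> rcases hc₂ y with h2 | h2 <;> simp [h1, h2])
    rw [e, hind]
  have mb0123 : ex ν (b 0 * b 1 * b 2 * b 3) = ex ν c₁ * ex ν c₂ := by
    have e : (b 0 * b 1 * b 2 * b 3 : β → ℝ) = c₁ * c₂ := by
      funext y; simp only [hb0, hb1, hb2, hb3, Pi.mul_apply]
      all_goals (rcases hc₁ y with h1 | h1 <;> rcases hc₂ y with h2 | h2 <;> simp [h1, h2])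
    rw [e, hind]
  have cm0 : (fun (i : Fin 4) (p : γ × β) => a i p.1 + b i p.2 - a i p.1 * b i p.2) 0 * (fun (i : Fin 4) (p : γ × β) => a i p.1 + b i p.2 - a i p.1 * b i p.2) 3 * (fun (i : Fin 4) (p : γ × β) => a i p.1 + b i p.2 - a i p.1 * b i p.2) 1 * (fun (i : Fin 4) (p : γ × β) => a i p.1 + b i p.2 - a i p.1 * b i p.2) 2 = (fun (i : Fin 4) (p : γ × β) => a i p.1 + b i p.2 - a i p.1 * b i p.2) 0 * (fun (i : Fin 4) (p : γ × β) => a i p.1 + b i p.2 - a i p.1 * b i p.2) 1 * (fun (i : Fin 4) (p : γ × β) => a i p.1 + b i p.2 - a i p.1 * b i p.2) 2 * (fun (i : Fin 4) (p : γ × β) => a i p.1 + b i p.2 - a i p.1 * b i p.2) 3 := by funext p; simp only [Pi.mul_apply]; ring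
  have cm1 : (fun (i : Fin 4) (p : γ × β) => a i p.1 + b i p.2 - a i p.1 * b i p.2) 0 * (fun (i : Fin 4) (p : γ × β) => a i p.1 + b i p.2 - a i p.1 * b i p.2) 3 * (fun (i : Fin 4) (p : γ × β) => a i p.1 + b i p.2 - a i p.1 * b i p.2) 2 = (fun (i : Fin 4) (p : γ × β) => a i p.1 + b i p.2 - a i p.1 * b i p.2) 0 * (fun (i : Fin 4) (p : γ × β) => a i p.1 + b i p.2 - a i p.1 * b i p.2) 2 * (fun (i : Fin 4) (p : γ × β) => a i p.1 + b i p.2 - a i p.1 * b i p.2) 3 := by funext p; simp only [Pi.mul_apply]; ring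
  have cm2 : (fun (i : Fin 4) (p : γ × β) => a i p.1 + b i p.2 - a i p.1 * b i p.2) 0 * (fun (i : Fin 4) (p : γ × β) => a i p.1 + b i p.2 - a i p.1 * b i p.2) 3 * (fun (i : Fin 4) (p : γ × β) => a i p.1 + b i p.2 - a i p.1 * b i p.2) 1 = (fun (i : Fin 4) (p : γ × β) => a i p.1 + b i p.2 - a i p.1 * b i p.2) 0 * (fun (i : Fin 4) (p : γ × β) => a i p.1 + b i p.2 - a i p.1 * b i p.2) 1 * (fun (i : Fin 4) (p : γ × β) => a i p.1 + b i p.2 - a i p.1 * b i p.2) 3 := by funext p; simp only [Pi.mul_apply]; ring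
  rw [sahiE_three, cm0, cm1, cm2, uMoment_0123 μ ν hμ1 hν1 a b, uMoment_023 μ ν hμ1 hν1 a b, uMoment_013 μ ν hμ1 hν1 a b, uMoment_12 μ ν hμ1 hν1 a b, uMoment_03 μ ν hμ1 hν1 a b, uMoment_1 μ ν hμ1 hν1 a b, uMoment_2 μ ν hμ1 hν1 a b]
  rw [exFail_0 μ hμ1 a, exFail_1 μ hμ1 a, exFail_2 μ hμ1 a, exFail_3 μ hμ1 a, exFail_01 μ hμ1 a, exFail_02 μ hμ1 a, exFail_03 μ hμ1 a, exFail_12 μ hμ1 a, exFail_13 μ hμ1 a, exFail_23 μ hμ1 a, exFail_012 μ hμ1 a, exFail_013 μ hμ1 a, exFail_023 μ hμ1 a, exFail_123 μ hμ1 a, exFail_0123 μ hμ1 a]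
  rw [exFail_0 ν hν1 b, exFail_1 ν hν1 b, exFail_2 ν hν1 b, exFail_3 ν hν1 b, exFail_01 ν hν1 b, exFail_02 ν hν1 b, exFail_03 ν hν1 b, exFail_12 ν hν1 b, exFail_13 ν hν1 b, exFail_23 ν hν1 b, exFail_012 ν hν1 b, exFail_013 ν hν1 b, exFail_023 ν hν1 b, exFail_123 ν hν1 b, exFail_0123 ν hν1 b]
  rw [mb0, mb1, mb2, mb3, mb01, mb02, mb03, mb12, mb13, mb23, mb012, mb013, mb023, mb123, mb0123]
  linear_combination e3prod03_orTwoCoinY_nonneg_explicit (ex μ (a 0)) (ex μ (a 1)) (ex μ (a 2)) (ex μ (a 3)) (ex μ (a 0 * a 1)) (ex μ (a 0 * a 2)) (ex μ (a 0 * a 3)) (ex μ (a 1 * a 2)) (ex μ (a 1 * a 3)) (ex μ (a 2 * a 3)) (ex μ (a 0 * a 1 * a 2)) (ex μ (a 0 * a 1 * a 3)) (ex μ (a 0 * a 2 * a 3)) (ex μ (a 1 * a 2 * a 3)) (ex μ (a 0 * a 1 * a 2 * a 3)) (ex ν c₁) (ex ν c₂) hT h10 h11 h20 h21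

set_option maxHeartbeats 1600000 in
set_option maxRecDepth 8000 in
/-- `e3prod12_orTwoCoinY_nonneg` restated with powers written as repeated products (elaboration-friendly form). [this work] -/
theorem e3prod12_orTwoCoinY_nonneg' (t : Fin 15 → ℝ) (α β : ℝ) (hT : AAdmissible t) (hα0 : 0 ≤ α) (hα1 : α ≤ 1) (hβ0 : 0 ≤ β) (hβ1 : β ≤ 1) :
    0 ≤ 2 * t 14 - t 0 * t 13 - t 3 * t 10 - t 6 * t 7 + t 6 * β + t 13 * α - 2 * t 14 * α - 2 * t 14 * β + 2 * α * β + t 0 * t 3 * t 7 - t 0 * t 3 * β + t 0 * t 13 * α + t 0 * t 13 * β - t 0 * α * β - t 3 * t 7 * α + t 3 * t 10 * α + t 3 * t 10 * β - 2 * t 3 * α * β + t 6 * t 7 * α + t 6 * t 7 * β - t 6 * α * β - t 7 * α * β - t 10 * α * β - t 13 * α * β + 2 * t 14 * α * β - α * β * β - α * α * β - t 0 * t 3 * t 7 * α - t 0 * t 3 * t 7 * β + 2 * t 0 * t 3 * α * β + t 0 * t 7 * α * β - t 0 * t 13 * α * β + t 0 * α * α * β + 2 * t 3 * t 7 * α *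 β + t 3 * α * β * β + t 3 * α * α * β - t 6 * t 7 * α * β + t 7 * α * β * β + t 10 * α * β * β + t 10 * α * α * β - t 0 * t 3 * α * α * β - t 0 * t 7 * α * β * β - t 0 * t 7 * α * α * β - t 3 * t 7 * α * β * β - t 3 * t 10 * α * β * β - t 3 * t 10 * α * α * β - t 10 * α * α * β * β + t 0 * t 3 * t 7 * α * β * β + t 0 * t 3 * t 7 * α * α * β + t 0 * t 7 * α * α * β * β + t 3 * t 10 * α * α * β * β - t 0 * t 3 * t 7 * α * α * β * β := by
  have h := e3prod12_orTwoCoinY_nonneg t α β hT hα0 hα1 hβ0 hβ1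
  linear_combination h

set_option maxRecDepth 8000 in
/-- `e3prod12_orTwoCoinY_nonneg` with the fifteen hold moments as named reals. [this work] -/
theorem e3prod12_orTwoCoinY_nonneg_explicit (t0 t1 t2 t3 t01 t02 t03 t12 t13 t23 t012 t013 t023 t123 t0123 θ₁ θ₂ : ℝ)
    (hT : AAdmissible ![t0, t1, t2, t3, t01, t02, t03, t12, t13, t23, t012, t013, t023, t123, t0123]) (h10 : 0 ≤ θ₁) (h11 : θ₁ ≤ 1) (h20 : 0 ≤ θ₂) (h21 : θ₂ ≤ 1) :
    0 ≤ 2 * t0123 - t0 * t123 - t3 * t012 - t03 * t12 + t03 * θ₂ + t123 * θ₁ - 2 * t0123 * θ₁ - 2 * t0123 * θ₂ + 2 * θ₁ * θ₂ + t0 * t3 * t12 - t0 * t3 * θ₂ + t0 * t123 * θ₁ + t0 * t123 * θ₂ - t0 * θ₁ * θ₂ - t3 * t12 * θ₁ + t3 * t012 * θ₁ + t3 * t012 * θ₂ - 2 * t3 * θ₁ * θ₂ + t03 * t12 * θ₁ + t03 * t12 * θ₂ - t03 * θ₁ * θ₂ - t12 * θ₁ * θ₂ - t012 * θ₁ * θ₂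 - t123 * θ₁ * θ₂ + 2 * t0123 * θ₁ * θ₂ - θ₁ * θ₂ * θ₂ - θ₁ * θ₁ * θ₂ - t0 * t3 * t12 * θ₁ - t0 * t3 * t12 * θ₂ + 2 * t0 * t3 * θ₁ * θ₂ + t0 * t12 * θ₁ * θ₂ - t0 * t123 * θ₁ * θ₂ + t0 * θ₁ * θ₁ * θ₂ + 2 * t3 * t12 * θ₁ * θ₂ + t3 * θ₁ * θ₂ * θ₂ + t3 * θ₁ * θ₁ * θ₂ - t03 * t12 * θ₁ * θ₂ + t12 * θ₁ * θ₂ * θ₂ + t012 * θ₁ * θ₂ * θ₂ + t012 * θ₁ * θ₁ * θ₂ - t0 * t3 * θ₁ * θ₁ * θ₂ - t0 * t12 * θ₁ * θ₂ * θ₂ - t0 * t12 * θ₁ * θ₁ * θ₂ - t3 * t12 * θ₁ * θ₂ * θ₂ - t3 * t012 * θ₁ * θ₂ * θ₂ - t3 * t012 * θ₁ * θ₁ * θ₂ - t012 * θ₁ * θ₁ * θ₂ * θ₂ + t0 * t3 * t12 * θ₁ * θ₂ * θ₂ + t0 * t3 * t12 * θ₁ * θ₁ * θ₂ + t0 * t12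 * θ₁ * θ₁ * θ₂ * θ₂ + t3 * t012 * θ₁ * θ₁ * θ₂ * θ₂ - t0 * t3 * t12 * θ₁ * θ₁ * θ₂ * θ₂ := by
  have h := e3prod12_orTwoCoinY_nonneg' _ θ₁ θ₂ hT h10 h11 h20 h21
  exact h

set_option maxHeartbeats 4000000 in
set_option maxRecDepth 100000 in
/-- **`E₃(u_1u_2, u_0, u_3) ≥ 0` (order-3 product row) for the OR with the independent two-coin block `b = (c₁, c₂, c₂, c₁c₂)`** (measure level, hypotheses as in `sahiE_four_orTwoCoinY_nonneg`). [this work] -/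
theorem sahiE_three_prodRow12_orTwoCoinY_nonneg (μ : γ → ℝ) (ν : β → ℝ)
    (hμ0 : ∀ t, 0 ≤ μ t) (hμ1 : ∑ t, μ t = 1) (hν0 : ∀ t, 0 ≤ ν t) (hν1 : ∑ t, ν t = 1) (hμ2 : SahiPositive μ 2)
    (a : Fin 4 → γ → ℝ) (b : Fin 4 → β → ℝ) (ha0 : ∀ i t, 0 ≤ a i t) (ha1 : ∀ i t, a i t ≤ 1) (ham : ∀ i, Monotone (a i))
    (c₁ c₂ : β → ℝ) (hc₁ : ∀ y, c₁ y = 0 ∨ c₁ y = 1) (hc₂ : ∀ y, c₂ y = 0 ∨ c₂ y = 1) (hind : ex ν (c₁ * c₂) = ex ν c₁ * ex ν c₂)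
    (hb0 : b 0 = c₁) (hb1 : b 1 = c₂) (hb2 : b 2 = c₂) (hb3 : b 3 = c₁ * c₂) (h : H4Plus μ a) :
    0 ≤ sahiE (fun p : γ × β => μ p.1 * ν p.2) 3 ![(fun (i : Fin 4) (p : γ × β) => a i p.1 + b i p.2 - a i p.1 * b i p.2) 1 * (fun (i : Fin 4) (p : γ × β) => a i p.1 + b i p.2 - a i p.1 * b i p.2) 2, (fun (i : Fin 4) (p : γ × β) => a i p.1 + b i p.2 - a i p.1 * b i p.2) 0, (fun (i : Fin 4) (p : γ × β) => a i p.1 + b i p.2 - a i p.1 * b i p.2) 3] := by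
  have hT := aAdmissible_of_h4Plus μ hμ0 hμ1 hμ2 a ha0 ha1 ham h
  have h10 : 0 ≤ ex ν c₁ := ex_nonneg hν0 (fun y => by rcases hc₁ y with e | e <;> simp [e])
  have h11 : ex ν c₁ ≤ 1 := by
    have t := ex_mono hν0 (fun y => show c₁ y ≤ (fun _ => (1:ℝ)) y by rcases hc₁ y with e | e <;> simp [e]); rw [ex_const hν1] at t; exact t
  have h20 : 0 ≤ ex ν c₂ := ex_nonneg hν0 (fun y => by rcases hc₂ y with e | e <;> simp [e])
  have h21 : ex ν c₂ ≤ 1 := by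
    have t := ex_mono hν0 (fun y => show c₂ y ≤ (fun _ => (1:ℝ)) y by rcases hc₂ y with e | e <;> simp [e]); rw [ex_const hν1] at t; exact t
  have mb0 : ex ν (b 0) = ex ν c₁ := by rw [hb0]
  have mb1 : ex ν (b 1) = ex ν c₂ := by rw [hb1]
  have mb2 : ex ν (b 2) = ex ν c₂ := by rw [hb2]
  have mb3 : ex ν (b 3) = ex ν c₁ * ex ν c₂ := by rw [hb3, hind]
  have mb01 : ex ν (b 0 * b 1) = ex ν c₁ * ex ν c₂ := by
    have e : (b 0 * b 1 : β → ℝ) = c₁ * c₂ := by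
      funext y; simp only [hb0, hb1, Pi.mul_apply]
    rw [e, hind]
  have mb02 : ex ν (b 0 * b 2) = ex ν c₁ * ex ν c₂ := by
    have e : (b 0 * b 2 : β → ℝ) = c₁ * c₂ := by
      funext y; simp only [hb0, hb2, Pi.mul_apply]
    rw [e, hind]
  have mb03 : ex ν (b 0 * b 3) = ex ν c₁ * ex ν c₂ := by
    have e : (b 0 * b 3 : β → ℝ) = c₁ * c₂ := by
      funext y; simp only [hb0, hb3, Pi.mul_apply]
      all_goals (rcases hc₁ y with h1 | h1 <;> rcases hc₂ y with h2 | h2 <;> simp [h1, h2])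
    rw [e, hind]
  have mb12 : ex ν (b 1 * b 2) = ex ν c₂ := by
    have e : (b 1 * b 2 : β → ℝ) = c₂ := by
      funext y; simp only [hb1, hb2, Pi.mul_apply]
      all_goals (rcases hc₂ y with h2 | h2 <;> simp [h2])
    rw [e]
  have mb13 : ex ν (b 1 * b 3) = ex ν c₁ * ex ν c₂ := by
    have e : (b 1 * b 3 : β → ℝ) = c₁ * c₂ := by
      funext y; simp only [hb1, hb3, Pi.mul_apply]
      all_goals (rcases hc₁ y with h1 | h1 <;> rcases hc₂ y with h2 | h2 <;> simp [h1, h2])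
    rw [e, hind]
  have mb23 : ex ν (b 2 * b 3) = ex ν c₁ * ex ν c₂ := by
    have e : (b 2 * b 3 : β → ℝ) = c₁ * c₂ := by
      funext y; simp only [hb2, hb3, Pi.mul_apply]
      all_goals (rcases hc₁ y with h1 | h1 <;> rcases hc₂ y with h2 | h2 <;> simp [h1, h2])
    rw [e, hind]
  have mb012 : ex ν (b 0 * b 1 * b 2) = ex ν c₁ * ex ν c₂ := by
    have e : (b 0 * b 1 * b 2 : β → ℝ) = c₁ * c₂ := by
      funext y; simp only [hb0, hb1, hb2, Pi.mul_apply]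
      all_goals (rcases hc₁ y with h1 | h1 <;> rcases hc₂ y with h2 | h2 <;> simp [h1, h2])
    rw [e, hind]
  have mb013 : ex ν (b 0 * b 1 * b 3) = ex ν c₁ * ex ν c₂ := by
    have e : (b 0 * b 1 * b 3 : β → ℝ) = c₁ * c₂ := by
      funext y; simp only [hb0, hb1, hb3, Pi.mul_apply]
      all_goals (rcases hc₁ y with h1 | h1 <;> rcases hc₂ y with h2 | h2 <;> simp [h1, h2])
    rw [e, hind]
  have mb023 : ex ν (b 0 * b 2 * b 3) = ex ν c₁ * ex ν c₂ := by
    have e : (b 0 * b 2 * b 3 : β → ℝ) = c₁ * c₂ := by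
      funext y; simp only [hb0, hb2, hb3, Pi.mul_apply]
      all_goals (rcases hc₁ y with h1 | h1 <;> rcases hc₂ y with h2 | h2 <;> simp [h1, h2])
    rw [e, hind]
  have mb123 : ex ν (b 1 * b 2 * b 3) = ex ν c₁ * ex ν c₂ := by
    have e : (b 1 * b 2 * b 3 : β → ℝ) = c₁ * c₂ := by
      funext y; simp only [hb1, hb2, hb3, Pi.mul_apply]
      all_goals (rcases hc₁ y with h1 | h1 <;> rcases hc₂ y with h2 | h2 <;> simp [h1, h2])
    rw [e, hind]
  have mb0123 : ex ν (b 0 * b 1 * b 2 * b 3) = ex ν c₁ * ex ν c₂ := by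
    have e : (b 0 * b 1 * b 2 * b 3 : β → ℝ) = c₁ * c₂ := by
      funext y; simp only [hb0, hb1, hb2, hb3, Pi.mul_apply]
      all_goals (rcases hc₁ y with h1 | h1 <;> rcases hc₂ y with h2 | h2 <;> simp [h1, h2])
    rw [e, hind]
  have cm0 : (fun (i : Fin 4) (p : γ × β) => a i p.1 + b i p.2 - a i p.1 * b i p.2) 1 * (fun (i : Fin 4) (p : γ × β) => a i p.1 + b i p.2 - a i p.1 * b i p.2) 2 * (fun (i : Fin 4) (p : γ × β) => a i p.1 + b i p.2 - a i p.1 * b i p.2) 0 * (fun (i : Fin 4) (p : γ × β) => a i p.1 + b i p.2 - a i p.1 * b i p.2) 3 = (fun (i : Fin 4) (p : γ × β) => a i p.1 + b i p.2 - a i p.1 * b i p.2) 0 * (fun (i : Fin 4) (p : γ × β) => a i p.1 + b i p.2 - a i p.1 * b i p.2) 1 * (fun (i : Fin 4) (p : γ × β) => a i p.1 + b i p.2 - a i p.1 * b i p.2) 2 * (fun (i : Fin 4) (p : γ × β) => a i p.1 + b i p.2 - a i p.1 * b i p.2) 3 := by funext p; simp only [Pi.mul_apply]; ring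
  have cm2 : (fun (i : Fin 4) (p : γ × β) => a i p.1 + b i p.2 - a i p.1 * b i p.2) 1 * (fun (i : Fin 4) (p : γ × β) => a i p.1 + b i p.2 - a i p.1 * b i p.2) 2 * (fun (i : Fin 4) (p : γ × β) => a i p.1 + b i p.2 - a i p.1 * b i p.2) 0 = (fun (i : Fin 4) (p : γ × β) => a i p.1 + b i p.2 - a i p.1 * b i p.2) 0 * (fun (i : Fin 4) (p : γ × β) => a i p.1 + b i p.2 - a i p.1 * b i p.2) 1 * (fun (i : Fin 4) (p : γ × β) => a i p.1 + b i p.2 - a i p.1 * b i p.2) 2 := by funext p; simp only [Pi.mul_apply]; ring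
  rw [sahiE_three, cm0, cm2, uMoment_0123 μ ν hμ1 hν1 a b, uMoment_123 μ ν hμ1 hν1 a b, uMoment_012 μ ν hμ1 hν1 a b, uMoment_03 μ ν hμ1 hν1 a b, uMoment_12 μ ν hμ1 hν1 a b, uMoment_0 μ ν hμ1 hν1 a b, uMoment_3 μ ν hμ1 hν1 a b]
  rw [exFail_0 μ hμ1 a, exFail_1 μ hμ1 a, exFail_2 μ hμ1 a, exFail_3 μ hμ1 a, exFail_01 μ hμ1 a, exFail_02 μ hμ1 a, exFail_03 μ hμ1 a, exFail_12 μ hμ1 a, exFail_13 μ hμ1 a, exFail_23 μ hμ1 a, exFail_012 μ hμ1 a, exFail_013 μ hμ1 a, exFail_023 μ hμ1 a, exFail_123 μ hμ1 a, exFail_0123 μ hμ1 a]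
  rw [exFail_0 ν hν1 b, exFail_1 ν hν1 b, exFail_2 ν hν1 b, exFail_3 ν hν1 b, exFail_01 ν hν1 b, exFail_02 ν hν1 b, exFail_03 ν hν1 b, exFail_12 ν hν1 b, exFail_13 ν hν1 b, exFail_23 ν hν1 b, exFail_012 ν hν1 b, exFail_013 ν hν1 b, exFail_023 ν hν1 b, exFail_123 ν hν1 b, exFail_0123 ν hν1 b]
  rw [mb0, mb1, mb2, mb3, mb01, mb02, mb03, mb12, mb13, mb23, mb012, mb013, mb023, mb123, mb0123]
  linear_combination e3prod12_orTwoCoinY_nonneg_explicit (ex μ (a 0)) (ex μ (a 1)) (ex μ (a 2)) (ex μ (a 3)) (ex μ (a 0 * a 1)) (ex μ (a 0 * a 2)) (ex μ (a 0 * a 3)) (ex μ (a 1 * a 2)) (ex μ (a 1 * a 3)) (ex μ (a 2 * a 3)) (ex μ (a 0 * a 1 * a 2)) (ex μ (a 0 * a 1 * a 3)) (ex μ (a 0 * a 2 * a 3)) (ex μ (a 1 * a 2 * a 3)) (ex μ (a 0 * a 1 * a 2 * a 3)) (ex ν c₁) (ex ν c₂) hT h10 h11 h20 h21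

end Summit.CriticalPhenomena.PercolationContinuityZ3.Theorems.SahiE4UnionTwoCoin

end
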